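import Literature.Probability.LatticeModels.SHolomorphicityProof
import Literature.Probability.LatticeModels.InnerFacesHoleFree
import Literature.Probability.Percolation.FKLoopWindingCells

/-!
# Orientation of the loop at an interior medial vertex touched by the exploration (stub S2, part 1)

Helper file for the crux `CardySusyWard.ParafermionFamiliesToSLESix` (stmt-CriticalPhenomena-10814),
line `strip-anchored-vertex-normalisation`, stub `stub_halfCRVertexRelation` (S2: the half
Cauchy–Riemann vertex relation of Duminil-Copin 2012, Prop. 4 / Duminil-Copin–Smirnov 2012,
Prop. 8.6 at `q = 1`, spin `1/3`).  The proof of S2 pairs `ω` with `ω △ {e}`; the only input beyond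
the FK-Ising template of the tree (`InterfaceRearrangement`, `PairIdentities`) is the SIGN of the
rotation number of the loop through the corner of `e` not used by the exploration path — at spin
`1/2` only its parity matters, at spin `1/3` the phase `e^{∓ 2πi/3}` sees the orientation.

**Theorem** (`loopTurn_eq`).  Let `β` be a configuration, `c₀` a start corner of the Dobrushin data
`D` whose set of inner faces is hole-free, `orb` the orbit of `c₀`, `N` a time, `q = orb i₁`
(`i₁ < N`) a corner arriving at the edge `e = cTgt q` all of whose endpoints' faces are inner, and
let the cycle `L` (minimal period `Q`) of the turning rule through the partner `q₂` of `q` consist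
of corners with inner faces, none of which is `orb i`, `i < N`.  Then
`∑_{m<Q} turnSign β (L m) = 4` if `e` is closed and `= -4` if `e` is open: `L` turns
counter-clockwise iff it crosses `e`.

Proof (winding numbers of the coded closed trail of `L`, `MedialTrailUmlaufsatz`): by the tube
lemma the winding number `w` of `L` is one constant `a` on the cells left and right of the darts
`orb 0, …, orb (N-1)`; at the start `a` is the winding number of the non-inner face across `e_a`
(the two corners through the midpoint of `e_a` with that face are not on `L`, nor is `c₀`), which
vanishes: `w` is constant along chains of side-adjacent non-inner faces (again the tube lemma) and
such a chain reaches faces beyond the bounding box of `L` (`HoleFree`).  So `w = 0` on the cells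
at `q` and at `nextCorner β q`; one of them is the cell right of the dart of `q₂` if `e` is closed
(the common face of `q₂` and `(q.1, q.2 + 1)`), the cell left of it if `e` is open (the vertex of
`q₂`), and `inv_cornerOrbit` (`w ∈ {0, 1}` and rotation `+4`, or `w ∈ {0, -1}` and rotation `-4`,
with `w(left) = w(right) + 1` across a dart of `L`) decides the sign.
-/

noncomputable section

namespace Summit.CriticalPhenomena.CardyFormulaZ2.Theorems.ParafermionFamiliesToSLESix.StripAnchored

open Finset
open Literature.Probability.Percolation (BondConfig vcell fcell cornerDart cornerDart_eq isDart_cornerDart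
  cornerDart_injective lf_cornerDart rf_cornerDart)
open Literature.Probability.LatticeModels
open Literature.Probability.LatticeModels.MedialTrail (wnd lf rf IsDart IsTrail cdarts tube wnd_lf_eq_rf)

namespace S2

variable {β : BondConfig (Site 2)}

/-! ## The coded closed trail of a cycle of the turning rule -/

/-- The coded closed trail (medial coordinates `cpos`) of the first `Q` corners of the orbit of `q`
under the turning rule of `β` (a notation, so that this helper file introduces no definition). -/
local notation "loopTrail(" β ", " q ", " Q ")" =>
  List.map (fun m => cpos (cornerOrbit β q m)) (List.range Q)

variable {q : Site 2 × Fin 4} {Q : ℕ}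

/-- A cycle of minimal period codes a closed trail of the oriented medial graph. [folklore] -/
theorem isTrail_loopTrail (hQ0 : 0 < Q) (hQ : cornerOrbit β q Q = q)
    (hQmin : ∀ s, 0 < s → s < Q → cornerOrbit β q s ≠ q) : IsTrail (loopTrail(β, q, Q)) :=
  isTrail_cornerOrbit hQ0 hQ hQmin

/-- The darts of the coded trail are the darts of the corners of the cycle. [folklore] -/
theorem cdarts_loopTrail (hQ : cornerOrbit β q Q = q) :
    cdarts (loopTrail(β, q, Q)) = (List.range Q).map fun m => cornerDart (cornerOrbit β q m) := by
  rw [MedialTrail.cdarts_map_range (fun m => cpos (cornerOrbit β q m)) (by simp only [hQ]; rfl)]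
  refine List.map_congr_left fun m _ => ?_
  rw [cornerDart_eq β]
  rfl

/-- A corner whose dart is a dart of the coded trail is a corner of the cycle. [folklore] -/
theorem exists_eq_of_mem_cdarts (hQ : cornerOrbit β q Q = q) {c : Site 2 × Fin 4}
    (h : cornerDart c ∈ cdarts (loopTrail(β, q, Q))) : ∃ m, cornerOrbit β q m = c := by
  rw [cdarts_loopTrail hQ, List.mem_map] at h
  obtain ⟨m, -, hm⟩ := h
  exact ⟨m, cornerDart_injective hm⟩

/-- The dart of the base corner is a dart of the coded trail. [folklore] -/
theorem cornerDart_mem_cdarts (hQ0 : 0 < Q) (hQ : cornerOrbit β q Q = q) :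
    cornerDart q ∈ cdarts (loopTrail(β, q, Q)) := by
  rw [cdarts_loopTrail hQ, List.mem_map]
  exact ⟨0, List.mem_range.2 hQ0, rfl⟩

/-- Far above the bounding box of the cycle, the winding number of the coded trail around the cell
of a lattice face vanishes. [folklore] -/
theorem exists_wnd_fcell_eq_zero (hQ0 : 0 < Q) (hQ : cornerOrbit β q Q = q)
    (hQmin : ∀ s, 0 < s → s < Q → cornerOrbit β q s ≠ q) :
    ∃ M : ℤ, ∀ g : Site 2, M ≤ g 1 → wnd (loopTrail(β, q, Q)) (fcell g) = 0 := by
  obtain ⟨m, hm⟩ := MedialTrail.exists_upper_bounds (loopTrail(β, q, Q))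
  refine ⟨m, fun g hg => ?_⟩
  rw [fcell]
  by_cases h0 : 0 ≤ g 0
  · exact MedialTrail.wnd_eq_zero_of_ge (isTrail_loopTrail hQ0 hQ hQmin).2.2 fun P hP => by
      have := (hm P hP).1; omega
  · exact MedialTrail.wnd_eq_zero_of_le fun P hP => by have := (hm P hP).2; omega

/-! ## The tube lemma, in lattice terms -/

/-- The dart of a corner ends where the dart of its cross-successor `(v, k + 1)` starts (the coded
position does not depend on the configuration). [folklore] -/
theorem cornerDart_snd_eq (c : Site 2 × Fin 4) : (cornerDart c).2 = (cornerDart (c.1, c.2 + 1)).1 := by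
  rw [cornerDart_eq (∅ : BondConfig (Site 2)) c, cornerDart,
    nextCorner_of_not_mem (show cTgt c ∉ (∅ : BondConfig (Site 2)) from fun h => h)]

/-- The dart of a corner ends where the dart of its successor starts. [folklore] -/
theorem cornerDart_snd_eq_nextCorner (c : Site 2 × Fin 4) :
    (cornerDart c).2 = (cornerDart (nextCorner β c)).1 := by
  rw [cornerDart_eq β c, cornerDart]

/-- **The tube lemma for two consecutive corner darts off the cycle** (`MedialTrail.tube` in lattice
terms): the cells left and right of both darts carry one winding number. [folklore] -/
theorem tube_cornerDart {l : List MedialTrail.Pt} (hl : ∀ e ∈ cdarts l, IsDart e.1 e.2) {c c' : Site 2 × Fin 4}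
    (hcc' : (cornerDart c).2 = (cornerDart c').1) (n1 : cornerDart c ∉ cdarts l) (n2 : cornerDart c' ∉ cdarts l) :
    wnd l (lf (cornerDart c)) = wnd l (rf (cornerDart c)) ∧ wnd l (lf (cornerDart c')) = wnd l (rf (cornerDart c)) ∧
      wnd l (rf (cornerDart c')) = wnd l (rf (cornerDart c)) := by
  have hpair : cornerDart c = ((cornerDart c).1, (cornerDart c').1) := Prod.ext rfl hcc'
  have h1 : IsDart (cornerDart c).1 (cornerDart c').1 := by
    have := isDart_cornerDart c; rwa [hcc'] at this
  have h2 : IsDart (cornerDart c').1 (cornerDart c').2 := isDart_cornerDart c'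
  rw [hpair] at n1
  have := tube hl h1 h2 n1 n2
  rw [← hpair] at this
  exact this

/-- **Tube across a lattice edge between two faces off the cycle.** If neither the corner `(v, j)`
nor its cross-successor `(v, j + 1)` is a corner of the cycle, the cells of their faces
`faceAt v j`, `faceAt v (j + 1)` have the same winding number. [folklore] -/
theorem wnd_fcell_faceAt_eq (hQ : cornerOrbit β q Q = q) (hl : ∀ e ∈ cdarts (loopTrail(β, q, Q)), IsDart e.1 e.2)
    (v : Site 2) (j : Fin 4) (h1 : ∀ m, cornerOrbit β q m ≠ (v, j)) (h2 : ∀ m, cornerOrbit β q m ≠ (v, j + 1)) :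
    wnd (loopTrail(β, q, Q)) (fcell (faceAt v (j + 1))) = wnd (loopTrail(β, q, Q)) (fcell (faceAt v j)) := by
  have n1 : cornerDart (v, j) ∉ cdarts (loopTrail(β, q, Q)) := fun h => by
    obtain ⟨m, hm⟩ := exists_eq_of_mem_cdarts hQ h; exact h1 m hm
  have n2 : cornerDart (v, j + 1) ∉ cdarts (loopTrail(β, q, Q)) := fun h => by
    obtain ⟨m, hm⟩ := exists_eq_of_mem_cdarts hQ h; exact h2 m hm
  obtain ⟨-, -, h3⟩ := tube_cornerDart hl (cornerDart_snd_eq (v, j)) n1 n2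
  rw [rf_cornerDart, rf_cornerDart] at h3
  exact h3

/-- **Winding numbers are constant along steps between side-adjacent faces off the cycle**, when the
corners of the cycle all have faces in `P` and the two faces are not in `P`. [folklore] -/
theorem wnd_fcell_eq_of_faceStep (hQ : cornerOrbit β q Q = q) (hl : ∀ e ∈ cdarts (loopTrail(β, q, Q)), IsDart e.1 e.2)
    {P : Set (Site 2)} (hP : ∀ m, cFace (cornerOrbit β q m) ∈ P) {g g' : Site 2} (hs : FaceStep P g g') :
    wnd (loopTrail(β, q, Q)) (fcell g) = wnd (loopTrail(β, q, Q)) (fcell g') := by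
  obtain ⟨hadj, hg, hg'⟩ := hs
  obtain ⟨j, rfl⟩ := exists_eq_add_cornerUnit hadj
  -- `g = faceAt v (j + 2)` and `g + u_j = faceAt v (j + 2 + 1)` for `v = g + cornerOff (j + 2)`
  set v : Site 2 := g + cornerOff (j + 2) with hv
  have e1 : faceAt v (j + 2) = g := by rw [faceAt, hv]; abel
  have e2 : faceAt v (j + 2 + 1) = g + cornerUnit j := by rw [faceAt_succ_eq, e1, fin4_add_two_add_two']
  have h1 : ∀ m, cornerOrbit β q m ≠ (v, j + 2) := fun m hm => hg (by
    have := hP m; rwa [hm, cFace, e1] at this)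
  have h2 : ∀ m, cornerOrbit β q m ≠ (v, j + 2 + 1) := fun m hm => hg' (by
    have := hP m; rwa [hm, cFace, e2] at this)
  have := wnd_fcell_faceAt_eq hQ hl v (j + 2) h1 h2
  rw [e1, e2] at this
  exact this.symm

/-- **A non-inner face has winding number zero** for a cycle of corners with inner faces of
hole-free Dobrushin data: follow a chain of side-adjacent non-inner faces beyond the bounding box.
[folklore] -/
theorem wnd_fcell_eq_zero_of_not_isInnerFace {D : DiscreteDobrushin} (hH : HoleFree {f : Site 2 | D.IsInnerFace f})
    (hQ0 : 0 < Q) (hQ : cornerOrbit β q Q = q) (hQmin : ∀ s, 0 < s → s < Q → cornerOrbit β q s ≠ q)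
    (hLin : ∀ m, D.IsInnerFace (cFace (cornerOrbit β q m))) {g : Site 2} (hg : ¬ D.IsInnerFace g) :
    wnd (loopTrail(β, q, Q)) (fcell g) = 0 := by
  obtain ⟨M, hM⟩ := exists_wnd_fcell_eq_zero hQ0 hQ hQmin
  obtain ⟨g', hg'M, hchain⟩ := hH g hg M
  have hl := (isTrail_loopTrail hQ0 hQ hQmin).2.2
  have key : ∀ g'', Relation.ReflTransGen (FaceStep {f : Site 2 | D.IsInnerFace f}) g g'' →
      wnd (loopTrail(β, q, Q)) (fcell g) = wnd (loopTrail(β, q, Q)) (fcell g'') := by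
    intro g'' h
    induction h with
    | refl => rfl
    | tail _ hs ih => exact ih.trans (wnd_fcell_eq_of_faceStep hQ hl hLin hs)
  rw [key g' hchain]
  exact hM g' hg'M

/-! ## The winding number along the exploration path -/

/-- **At the start**: the cell of the vertex of the start corner `c₀` has the winding number of the
non-inner face across `e_a`, if `c₀` is not a corner of the cycle (whose corners have inner faces):
the corner `(c₀.1, c₀.2 + 3)` arriving at `e_a` through that face and `c₀` are consecutive darts
off the cycle. [folklore] -/
theorem wnd_vcell_start_eq {D : DiscreteDobrushin} {c₀ : Site 2 × Fin 4} (hc₀ : D.IsStartCorner c₀)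
    (hQ : cornerOrbit β q Q = q) (hl : ∀ e ∈ cdarts (loopTrail(β, q, Q)), IsDart e.1 e.2)
    (hLin : ∀ m, D.IsInnerFace (cFace (cornerOrbit β q m))) (h0 : ∀ m, cornerOrbit β q m ≠ c₀) :
    wnd (loopTrail(β, q, Q)) (vcell c₀.1) = wnd (loopTrail(β, q, Q)) (fcell (faceAt c₀.1 (c₀.2 + 3))) := by
  set r : Site 2 × Fin 4 := (c₀.1, c₀.2 + 3) with hr
  have n1 : cornerDart r ∉ cdarts (loopTrail(β, q, Q)) := fun h => by
    obtain ⟨m, hm⟩ := exists_eq_of_mem_cdarts hQ h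
    exact hc₀.isOutEdge.2 (by have := hLin m; rwa [hm] at this)
  have n2 : cornerDart c₀ ∉ cdarts (loopTrail(β, q, Q)) := fun h => by
    obtain ⟨m, hm⟩ := exists_eq_of_mem_cdarts hQ h; exact h0 m hm
  have heq : (cornerDart r).2 = (cornerDart c₀).1 := by
    rw [cornerDart_snd_eq r, hr]
    show (cornerDart (c₀.1, c₀.2 + 3 + 1)).1 = _
    rw [fin4_add_three_add_one]
  obtain ⟨h1, -, -⟩ := tube_cornerDart hl heq n1 n2
  rw [lf_cornerDart, rf_cornerDart] at h1
  exact h1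

/-- **Along the exploration** (any orbit avoiding the cycle up to time `N`): the cells left and right
of the darts `orb 0, …, orb (N - 1)` all have the winding number of the cell of the start vertex.
[folklore] -/
theorem wnd_orbit_eq (c₀ : Site 2 × Fin 4) (hQ : cornerOrbit β q Q = q)
    (hl : ∀ e ∈ cdarts (loopTrail(β, q, Q)), IsDart e.1 e.2) {N : ℕ}
    (hdisj : ∀ m i, i < N → cornerOrbit β q m ≠ cornerOrbit β c₀ i) :
    ∀ i < N, wnd (loopTrail(β, q, Q)) (vcell (cornerOrbit β c₀ i).1) = wnd (loopTrail(β, q, Q)) (vcell c₀.1) ∧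
      wnd (loopTrail(β, q, Q)) (fcell (cFace (cornerOrbit β c₀ i))) = wnd (loopTrail(β, q, Q)) (vcell c₀.1) := by
  have hnot : ∀ i < N, cornerDart (cornerOrbit β c₀ i) ∉ cdarts (loopTrail(β, q, Q)) := fun i hi h => by
    obtain ⟨m, hm⟩ := exists_eq_of_mem_cdarts hQ h; exact hdisj m i hi hm
  intro i hi
  induction i with
  | zero =>
    refine ⟨rfl, ?_⟩
    have := wnd_lf_eq_rf hl (isDart_cornerDart (cornerOrbit β c₀ 0)) (hnot 0 hi)
    rw [lf_cornerDart, rf_cornerDart] at this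
    exact this.symm
  | succ i ih =>
    obtain ⟨-, ih2⟩ := ih (by omega)
    obtain ⟨-, h2, h3⟩ := tube_cornerDart hl (cornerDart_snd_eq_nextCorner (β := β) (cornerOrbit β c₀ i))
      (hnot i (by omega)) (hnot (i + 1) hi)
    rw [lf_cornerDart, rf_cornerDart] at h2
    rw [rf_cornerDart, rf_cornerDart] at h3
    exact ⟨h2.trans ih2, h3.trans ih2⟩

/-- The common face of the two corners `cornerPartner q` and `(q.1, q.2 + 1)` (both in the face across
the edge `cTgt q` from the face of `q`). [folklore] -/
theorem cFace_cornerPartner (q : Site 2 × Fin 4) : cFace (cornerPartner q) = faceAt q.1 (q.2 + 1) := by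
  show faceAt (q.1 + cornerUnit (q.2 + 1)) (q.2 + 2) = _
  rw [show q.2 + 2 = (q.2 + 1) + 1 from (fin4_add_one_add_one q.2).symm, faceAt_add_unit_succ]

/-! ## The orientation of the loop -/

/-- **Orientation of the loop through the partner of an arriving corner** (the topological input of
S2).  For a configuration `β`, a start corner `c₀` of Dobrushin data with hole-free inner faces, a
time `N` at which the face is not inner, a corner `q = orb i₁` (`i₁ < N`) of the orbit of `c₀` all of
whose vertex's faces are inner, and the cycle of minimal period `Q` of the turning rule through
`cornerPartner q`, made of corners with inner faces none of which is `orb i` (`i < N`): the turn signs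
around the cycle sum to `4 · turnSign β q`: `4` if the edge `cTgt q` is closed, `-4` if it is open.
[cite: Hopf1935, Satz I] -/
theorem loopTurn_eq {D : DiscreteDobrushin} (hH : HoleFree {f : Site 2 | D.IsInnerFace f})
    {c₀ : Site 2 × Fin 4} (hc₀ : D.IsStartCorner c₀)
    (hx : ∀ j, D.IsInnerFace (faceAt q.1 j))
    {N i₁ : ℕ} (hN : ¬ D.IsInnerFace (cFace (cornerOrbit β c₀ N)))
    (hQ0 : 0 < Q) (hQ : cornerOrbit β (cornerPartner q) Q = cornerPartner q)
    (hQmin : ∀ s, 0 < s → s < Q → cornerOrbit β (cornerPartner q) s ≠ cornerPartner q)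
    (hLin : ∀ m, D.IsInnerFace (cFace (cornerOrbit β (cornerPartner q) m)))
    (hdisj : ∀ m i, i < N → cornerOrbit β (cornerPartner q) m ≠ cornerOrbit β c₀ i)
    (hi₁ : cornerOrbit β c₀ i₁ = q) (hi₁N : i₁ < N) :
    ∑ m ∈ Finset.range Q, turnSign β (cornerOrbit β (cornerPartner q) m) = 4 * turnSign β q := by
  classical
  set q₂ := cornerPartner q with hq₂
  have hT := isTrail_loopTrail hQ0 hQ hQmin
  have hl := hT.2.2
  -- the winding number along the path is that of the non-inner face across `e_a`, i.e. zero
  have h0 : ∀ m, cornerOrbit β q₂ m ≠ c₀ := fun m h => hdisj m 0 (by omega) h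
  have ha : wnd (loopTrail(β, q₂, Q)) (vcell c₀.1) = 0 := by
    rw [wnd_vcell_start_eq hc₀ hQ hl hLin h0]
    exact wnd_fcell_eq_zero_of_not_isInnerFace hH hQ0 hQ hQmin hLin hc₀.isOutEdge.2
  have halong := wnd_orbit_eq c₀ hQ hl hdisj
  -- the next dart of the path is still before the exit
  have hsucc : cornerOrbit β c₀ (i₁ + 1) = nextCorner β q := by rw [← hi₁]; rfl
  have hin1 : D.IsInnerFace (cFace (cornerOrbit β c₀ (i₁ + 1))) := by
    rw [hsucc]
    by_cases he : cTgt q ∈ β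
    · rw [cFace_nextCorner_of_mem he]; exact hx q.2
    · rw [cFace_nextCorner_of_not_mem he]; exact hx _
  have hi₁N' : i₁ + 1 < N := lt_of_le_of_ne (by omega) fun h => hN (h ▸ hin1)
  obtain ⟨hv1, hf1⟩ := halong (i₁ + 1) hi₁N'
  rw [ha, hsucc] at hv1 hf1
  -- the dart of `q₂` is on the cycle; read off the type
  have hmem : cornerDart q₂ ∈ cdarts (loopTrail(β, q₂, Q)) := cornerDart_mem_cdarts hQ0 hQ
  have hinv : (∑ m ∈ Finset.range Q, turnSign β (cornerOrbit β q₂ m) = 4 ∧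
      ∀ F, wnd (loopTrail(β, q₂, Q)) F = 0 ∨ wnd (loopTrail(β, q₂, Q)) F = 1) ∨
      (∑ m ∈ Finset.range Q, turnSign β (cornerOrbit β q₂ m) = -4 ∧
      ∀ F, wnd (loopTrail(β, q₂, Q)) F = 0 ∨ wnd (loopTrail(β, q₂, Q)) F = -1) := inv_cornerOrbit hQ0 hQ hQmin
  have hjump := hT.wnd_lf hmem
  rw [lf_cornerDart, rf_cornerDart] at hjump
  by_cases he : cTgt q ∈ β
  · -- open: the path follows `e` to the vertex of `q₂`, whose cell is LEFT of the dart of `q₂`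
    rw [turnSign_of_mem he]
    rw [nextCorner_of_mem he] at hv1
    have hv : wnd (loopTrail(β, q₂, Q)) (vcell q₂.1) = 0 := hv1
    rcases hinv with ⟨_, hw⟩ | ⟨hs, -⟩
    · exfalso
      rcases hw (fcell (cFace q₂)) with h | h <;> omega
    · rw [hs]; norm_num
  · -- closed: the path crosses `e` into the face of `q₂`, whose cell is RIGHT of the dart of `q₂`
    rw [turnSign_of_not_mem he]
    rw [cFace_nextCorner_of_not_mem he, ← cFace_cornerPartner] at hf1
    have hf : wnd (loopTrail(β, q₂, Q)) (fcell (cFace q₂)) = 0 := hf1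
    rcases hinv with ⟨hs, -⟩ | ⟨_, hw⟩
    · rw [hs]; norm_num
    · exfalso
      rcases hw (vcell q₂.1) with h | h <;> omega

end S2

/-- **Registered one-line form of the orientation lemma** `S2.loopTurn_eq` (sub-goal `stub_halfCR_orientation` of
stmt-CriticalPhenomena-10814, part 1 of stub S2). [cite: Hopf1935, Satz I] -/
theorem stub_halfCR_orientation : ∀ (D : DiscreteDobrushin) (β : BondConfig (Site 2)) (c₀ q : Site 2 × Fin 4) (N Q i₁ : ℕ), HoleFree {f : Site 2 | D.IsInnerFace f} → D.IsStartCorner c₀ → (∀ j, D.IsInnerFace (faceAt q.1 j)) → ¬ D.IsInnerFace (cFace (cornerOrbit β c₀ N)) → 0 < Q → cornerOrbit β (cornerPartner q) Q = cornerPartner q → (∀ s, 0 < s → s < Q → cornerOrbit β (cornerPartner q) s ≠ cornerPartner q) → (∀ m, D.IsInnerFace (cFace (cornerOrbit β (cornerPartner q) m))) → (∀ m i, i < N → cornerOrbit β (cornerPartner q) m ≠ cornerOrbit β c₀ i) → cornerOrbit β c₀ i₁ = q → i₁ < N → ∑ m ∈ Finset.range Q, turnSign β (cornerOrbit β (cornerPartner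 q) m) = 4 * turnSign β q :=
  fun _ _ _ _ _ _ _ hH hc₀ hx hN hQ0 hQ hQmin hLin hdisj hi₁ hi₁N =>
    S2.loopTurn_eq hH hc₀ hx hN hQ0 hQ hQmin hLin hdisj hi₁ hi₁N

end Summit.CriticalPhenomena.CardyFormulaZ2.Theorems.ParafermionFamiliesToSLESix.StripAnchored

end
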